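import Literature.Topology.FourManifolds.ImmersionOrientation
import Literature.Topology.FourManifolds.TrisectionsCentralSurfaceLocal
import HarnessLib

/-!
# A compact manifold with boundary carrying an adapted Morse function with a single minimum is
# connected

Topic `Literature/Topology/FourManifolds`; a general lemma for the fact seat
`provefact-Literature.Topology.FourManifolds.exists-14560f9fc8` (named fact (c′)
`Literature.Topology.FourManifolds.exists_stabilized_gkTrisection`: the sectors and handlebodies
of a *modified* trisection are recognised from ambient Morse data, and their connectedness —
demanded by clauses (ii), (iii) of `Literature.Topology.FourManifolds.IsGKTrisection` — is read
off the handle counts `(1, k, 0, …)`).  Everything in this file is **proved**.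

Reeb's argument (Milnor, *Morse theory* (1963), proof of Thm. 4.1; §3): a Morse function
adapted to the boundary of a compact manifold `W` (`= 1` and regular on `∂W`, `< 1` inside)
attains its minimum on every closed-open piece at an interior local minimum, a critical point of
index `0`.  Hence if there is at most one critical point of index `0`:

* `IsMorseAdapted.isPreconnected_preimage_Iio_one` — `{f < 1} = W ∖ ∂W` is preconnected (the
  directed union of the connected sublevel sets `{f ≤ a}`, `a < 1`, of the tree's
  `IsMorseAdapted.isConnected_preimage_Iic`);
* `IsMorseAdapted.preconnectedSpace`, `IsMorseAdapted.connectedSpace_of_ncard_eq_one` — `W` is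
  (pre)connected, being the closure of `{f < 1}` (interior points are dense,
  `mem_closure_interior_halfSpace`); with exactly one critical point of index `0` it is nonempty,
  hence connected;
* `HasHandleDecomposition.connectedSpace` — a compact manifold with boundary with a handle
  decomposition with exactly one `0`-handle is connected.

## References

* J. Milnor, *Morse theory*, Ann. of Math. Studies 51 (1963), §3 and proof of Thm. 4.1.
  [Milnor1963]
-/

open scoped Manifold ContDiff Topology
open Set Function Filter

noncomputable section

namespace Literature.Topology.FourManifolds

universe u

variable {n : ℕ} {W : Type u} [TopologicalSpace W] [ChartedSpace (EuclideanHalfSpace (n + 1)) W]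
  [IsManifold (𝓡∂ (n + 1)) ∞ W] [CompactSpace W]

omit [IsManifold (𝓡∂ (n + 1)) ∞ W] in
/-- For a Morse function adapted to the boundary of a compact manifold with at most one critical
point of index `0`, the set `{f < 1}` is preconnected: it is the directed union of the connected
sublevel sets `{f ≤ a}`, `a < 1`. [cite: Milnor1963, §3 and proof of Thm. 4.1] -/
theorem IsMorseAdapted.isPreconnected_preimage_Iio_one {f : W → ℝ}
    (hf : IsMorseAdapted (𝓡∂ (n + 1)) f) (h0 : (criticalSetOfIndex (𝓡∂ (n + 1)) f 0).Subsingleton) :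
    IsPreconnected (f ⁻¹' Iio 1) := by
  have hunion : f ⁻¹' Iio 1 = ⋃₀ {s | ∃ a : ℝ, a < 1 ∧ (f ⁻¹' Iic a).Nonempty ∧ s = f ⁻¹' Iic a} := by
    ext x
    simp only [mem_preimage, mem_Iio, mem_sUnion, mem_setOf_eq]
    constructor
    · intro hx
      exact ⟨f ⁻¹' Iic (f x), ⟨f x, hx, ⟨x, show f x ≤ f x from le_rfl⟩, rfl⟩,
        show f x ≤ f x from le_rfl⟩
    · rintro ⟨s, ⟨a, ha, -, rfl⟩, hx⟩
      exact lt_of_le_of_lt hx ha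
  rw [hunion]
  refine IsPreconnected.sUnion_directed ?_ ?_
  · rintro s ⟨a, ha, hane, rfl⟩ t ⟨b, hb, hbne, rfl⟩
    refine ⟨f ⁻¹' Iic (max a b), ⟨max a b, max_lt ha hb, hane.mono ?_, rfl⟩, ?_, ?_⟩
    · exact preimage_mono (Iic_subset_Iic.2 (le_max_left _ _))
    · exact preimage_mono (Iic_subset_Iic.2 (le_max_left _ _))
    · exact preimage_mono (Iic_subset_Iic.2 (le_max_right _ _))
  · rintro s ⟨a, ha, hane, rfl⟩
    exact (hf.isConnected_preimage_Iic h0 ha hane).isPreconnected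

/-- **A compact manifold with boundary carrying a Morse function adapted to the boundary with at
most one critical point of index `0` is preconnected**: it is the closure of the preconnected set
`{f < 1} ⊇ W ∖ ∂W` (interior points are dense). [cite: Milnor1963, §3 and proof of Thm. 4.1] -/
theorem IsMorseAdapted.preconnectedSpace {f : W → ℝ} (hf : IsMorseAdapted (𝓡∂ (n + 1)) f)
    (h0 : (criticalSetOfIndex (𝓡∂ (n + 1)) f 0).Subsingleton) : PreconnectedSpace W := by
  have hpre := (hf.isPreconnected_preimage_Iio_one h0).closure
  have hdense : closure (f ⁻¹' Iio 1) = univ := by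
    apply eq_univ_of_forall
    intro b
    have hb : b ∈ closure ((𝓡∂ (n + 1)).interior W) :=
      mem_closure_interior_halfSpace (m := n + 1) (n := ∞) (by simp) b
    exact closure_mono (fun x hx => hf.2.2 x hx) hb
  rw [hdense] at hpre
  exact ⟨hpre⟩

/-- **A compact manifold with boundary carrying a Morse function adapted to the boundary with
exactly one critical point of index `0` is connected.** [cite: Milnor1963, §3 and proof of Thm. 4.1] -/
theorem IsMorseAdapted.connectedSpace_of_ncard_eq_one {f : W → ℝ}
    (hf : IsMorseAdapted (𝓡∂ (n + 1)) f) (h0 : (criticalSetOfIndex (𝓡∂ (n + 1)) f 0).ncard = 1) :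
    ConnectedSpace W := by
  obtain ⟨p, hp⟩ := Set.ncard_eq_one.1 h0
  haveI : Nonempty W := ⟨p⟩
  haveI := hf.preconnectedSpace (by rw [hp]; exact subsingleton_singleton)
  exact { toNonempty := ⟨p⟩ }

/-- **A compact manifold with boundary with a handle decomposition having exactly one `0`-handle is
connected** (the adapted Morse function presenting the decomposition has a single minimum).
[cite: Milnor1963, §3 and proof of Thm. 4.1] -/
theorem HasHandleDecomposition.connectedSpace {c : ℕ → ℕ} (h : HasHandleDecomposition n W c)
    (hc : c 0 = 1) : ConnectedSpace W := by
  obtain ⟨f, hf, hcount⟩ := h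
  exact hf.connectedSpace_of_ncard_eq_one (by rw [hcount 0, hc])

end Literature.Topology.FourManifolds
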